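import Mathlib
import HarnessLib
import Literature.NumberTheory.Sieve.BatemanHorn
import Summits.Parity.BatemanHorn.Theorems.AlmostPrimeZerosSystemZeroRepulsionEulerLemmas
import Summits.Parity.BatemanHorn.Theorems.AlmostPrimeZerosSystemZeroRepulsionEulerBoundComplex

/-!
# The real Euler-product bound (B) and both bounds together (stubs `stub_eulerBoundReal`, `stub_eulerProductBounds`)

Line `smooth-rough-lattice-acquisition` of crux stmt-Parity-11291
(`Summit.Parity.BatemanHorn.Theses.AlmostPrimeZeros.SystemZeroRepulsion`), stub S4.

With `π_p(b) = Σ_i ([p ∣ f_i(b)] + [p² ∣ f_i(b)])`, `E_p(t) = Σ_{b < p²} t^{π_p(b)}`, granting the local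
factor law (Stage A), for `Y ≥ Y₀(f)` and every `z ∈ ℂ`, `t = ‖z‖`:
`∏_{p ≤ Y} E_p(t)/p² ≤ (log Y)^{k(t − 1)} e^{C (t + 1)}`.
Proof: `t ≤ 1`: bad primes `≤ 1`, good primes `≤ exp(−ω(1−t)/p)` and the lower Mertens bound
(`stub_mertensOmega`); `t > 1`: bad primes `≤ t^{2k}`, good `p ≤ u = t+1` by `E_p(t)/p² ≤ (1+2D)u²/p²`
and `∏_{n ≤ u} K u²/n² ≤ e^{(log K+4)u}` (Stirling), good `p > u` by `1 + w ≤ e^w`, `Σ_{p>u} 1/p² ≤ 2/u`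
and the upper Mertens bound.  Finally `stub_eulerProductBounds` packages (Λ) (imported,
`stub_eulerBoundComplex`) and (B) with a common threshold and constant.
-/

noncomputable section

namespace Summit.Parity.BatemanHorn.Cruxes.SystemZeroRepulsion.SmoothRoughLatticeAcquisition

open Finset Literature.NumberTheory.Sieve

/-- Large good primes, real form: `E_p(t)/p² ≤ exp(ω(t−1)/p + D t (t−1)/p²)` for `t ≥ 1`. -/
private theorem locE_large_real {p ω D : ℕ} (hp : 1 ≤ p) (e : ℕ → ℕ) (hωD : ω ≤ D) {t : ℝ}
    (ht : 1 ≤ t) (hE : ∑ b ∈ range (p ^ 2), t ^ e b = (p : ℝ) ^ 2 + ω * (t - 1) * (p + t)) :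
    (∑ b ∈ range (p ^ 2), t ^ e b) / (p : ℝ) ^ 2 ≤
      Real.exp (ω * (t - 1) / p + D * t * (t - 1) / (p : ℝ) ^ 2) := by
  have hp0 : (0 : ℝ) < p := by exact_mod_cast hp
  rw [hE]
  refine le_trans ?_ (Real.add_one_le_exp _)
  rw [div_le_iff₀ (by positivity)]
  have hωD' : (ω : ℝ) ≤ D := by exact_mod_cast hωD
  have h1 : (ω : ℝ) * (t - 1) * t ≤ D * t * (t - 1) :=
    calc (ω : ℝ) * (t - 1) * t = ω * ((t - 1) * t) := by ring
      _ ≤ D * ((t - 1) * t) :=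
          mul_le_mul_of_nonneg_right hωD' (mul_nonneg (sub_nonneg.2 ht) (zero_le_one.trans ht))
      _ = D * t * (t - 1) := by ring
  have e : (ω * (t - 1) / p + D * t * (t - 1) / (p : ℝ) ^ 2 + 1) * (p : ℝ) ^ 2 =
      (p : ℝ) ^ 2 + ω * (t - 1) * p + D * t * (t - 1) := by field_simp; ring
  rw [e]
  nlinarith

/-- Small good primes, real form: `E_p(t)/p² ≤ (1 + 2D) u²/p²` for `1 ≤ t`, `p ≤ u = t + 1`. -/
private theorem locE_small_real {p ω D : ℕ} (hp : 1 ≤ p) (e : ℕ → ℕ) (hωD : ω ≤ D) {t : ℝ}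
    (ht : 1 ≤ t) (hpu : (p : ℝ) ≤ t + 1)
    (hE : ∑ b ∈ range (p ^ 2), t ^ e b = (p : ℝ) ^ 2 + ω * (t - 1) * (p + t)) :
    (∑ b ∈ range (p ^ 2), t ^ e b) / (p : ℝ) ^ 2 ≤ (1 + 2 * D) * (t + 1) ^ 2 / (p : ℝ) ^ 2 := by
  have hp0 : (0 : ℝ) < p := by exact_mod_cast hp
  rw [hE]
  gcongr
  have hωD' : (ω : ℝ) ≤ D := by exact_mod_cast hωD
  have h1 : (p : ℝ) ^ 2 ≤ (t + 1) ^ 2 := pow_le_pow_left₀ hp0.le hpu 2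
  have ha : (t - 1) * (p + t) ≤ (t + 1) * (2 * (t + 1)) :=
    mul_le_mul (by linarith) (by linarith) (by positivity) (by positivity)
  have hb : 0 ≤ (t - 1) * (p + t) := mul_nonneg (by linarith) (by positivity)
  have h2 : (ω : ℝ) * (t - 1) * (p + t) ≤ D * ((t + 1) * (2 * (t + 1))) :=
    calc (ω : ℝ) * (t - 1) * (p + t) = ω * ((t - 1) * (p + t)) := by ring
      _ ≤ D * ((t + 1) * (2 * (t + 1))) := mul_le_mul hωD' ha hb (Nat.cast_nonneg D)
  linarith [h1, h2]

/-- Good primes below the unit circle: `E_p(t)/p² ≤ exp(−ω(1−t)/p)` for `0 ≤ t ≤ 1`. -/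
private theorem locE_le_one_real {p ω : ℕ} (hp : 1 ≤ p) (e : ℕ → ℕ) {t : ℝ} (ht0 : 0 ≤ t)
    (ht : t ≤ 1) (hE : ∑ b ∈ range (p ^ 2), t ^ e b = (p : ℝ) ^ 2 + ω * (t - 1) * (p + t)) :
    (∑ b ∈ range (p ^ 2), t ^ e b) / (p : ℝ) ^ 2 ≤ Real.exp (-(ω * (1 - t) / p)) := by
  have hp0 : (0 : ℝ) < p := by exact_mod_cast hp
  rw [hE]
  refine le_trans ?_ (Real.add_one_le_exp _)
  rw [div_le_iff₀ (by positivity)]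
  have e : (-(ω * (1 - t) / p) + 1) * (p : ℝ) ^ 2 = (p : ℝ) ^ 2 + ω * (t - 1) * p := by
    field_simp; ring
  rw [e]
  have hω : (0 : ℝ) ≤ ω := Nat.cast_nonneg ω
  nlinarith [mul_nonneg hω ht0, mul_nonneg (mul_nonneg hω ht0) (sub_nonneg.2 ht)]

/-- **(B) engine.**  With the same local data, for `Y ≥ P₁` and real `t ≥ 0`:
`∏_{p ≤ Y} E_p(t)/p² ≤ (log Y)^{k(t−1)} e^{C(t+1)}`. -/
private theorem engine_real {k D P₁ : ℕ} {K : ℝ} (π : ℕ → ℕ → ℕ) (ω : ℕ → ℕ) (hP₁ : 3 ≤ P₁)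
    (hK : 0 ≤ K) (hπk : ∀ p b, π p b ≤ 2 * k)
    (hgood : ∀ p : ℕ, p.Prime → P₁ < p → ω p ≤ D ∧ ∀ t : ℝ,
      ∑ b ∈ range (p ^ 2), t ^ π p b = (p : ℝ) ^ 2 + ω p * (t - 1) * (p + t))
    (hM : ∀ P Y : ℝ, 3 ≤ P → P ≤ Y →
      |(∑ p ∈ (Nat.primesLE ⌊Y⌋₊).filter (fun p : ℕ => P < (p : ℝ)), (ω p : ℝ) / p) -
        k * (Real.log (Real.log Y) - Real.log (Real.log P))| ≤ K) :
    ∃ C : ℝ, 0 ≤ C ∧ ∀ Y : ℝ, (P₁ : ℝ) ≤ Y → ∀ t : ℝ, 0 ≤ t →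
      ∏ p ∈ Nat.primesLE ⌊Y⌋₊, (∑ b ∈ range (p ^ 2), t ^ π p b) / (p : ℝ) ^ 2 ≤
        Real.log Y ^ ((k : ℝ) * (t - 1)) * Real.exp (C * (t + 1)) := by
  classical
  have hk0 : (0 : ℝ) ≤ k := Nat.cast_nonneg k
  have hD0 : (0 : ℝ) ≤ D := Nat.cast_nonneg D
  have hP₁' : (3 : ℝ) ≤ P₁ := by exact_mod_cast hP₁
  have hllP₁ : 0 ≤ Real.log (Real.log P₁) := Real.log_nonneg
    (Literature.NumberTheory.LFunctions.MertensBound.one_lt_log_three.le.trans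
      (Real.log_le_log (by norm_num) hP₁'))
  set K₀ : ℝ := 1 + 2 * D with hK₀
  have hK₀1 : 1 ≤ K₀ := by rw [hK₀]; linarith
  have hlogK₀ : 0 ≤ Real.log K₀ := Real.log_nonneg hK₀1
  set C : ℝ := 2 * k * (P₁ + 1) + (Real.log K₀ + 4) + K + 2 * D +
    (k * Real.log (Real.log P₁) + K) with hC
  have hC0 : 0 ≤ C := by positivity
  refine ⟨C, hC0, fun Y hY t ht0 => ?_⟩
  have hY3 : 3 ≤ Y := hP₁'.trans hY
  have hY1 : 1 < Real.log Y := lt_of_lt_of_le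
    Literature.NumberTheory.LFunctions.MertensBound.one_lt_log_three (Real.log_le_log (by norm_num) hY3)
  have hllY : 0 ≤ Real.log (Real.log Y) := Real.log_nonneg hY1.le
  set S := Nat.primesLE ⌊Y⌋₊ with hS
  set g : ℕ → ℝ := fun p => (∑ b ∈ range (p ^ 2), t ^ π p b) / (p : ℝ) ^ 2 with hg
  have hg0 : ∀ p, 0 ≤ g p := fun p => locE_nonneg (π p) p ht0
  have hSgood : ∀ p ∈ S, (P₁ : ℝ) < p → 1 ≤ p ∧ ω p ≤ D ∧
      ∑ b ∈ range (p ^ 2), t ^ π p b = (p : ℝ) ^ 2 + ω p * (t - 1) * (p + t) := by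
    intro p hp hp1
    have hpp := (Nat.mem_primesLE.1 hp).2
    obtain ⟨hωD, hE⟩ := hgood p hpp (by exact_mod_cast hp1)
    exact ⟨hpp.one_le, hωD, hE t⟩
  have hexp : Real.log Y ^ ((k : ℝ) * (t - 1)) = Real.exp (k * (t - 1) * Real.log (Real.log Y)) := by
    rw [Real.rpow_def_of_pos (by linarith)]
    congr 1
    ring
  rw [hexp, ← Real.exp_add]
  rcases le_or_gt t 1 with ht1 | ht1
  · -- `t ≤ 1`: bad primes `≤ 1`, good primes by `E_p(t)/p² ≤ exp(−ω(1−t)/p)` and lower Mertens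
    rw [← prod_filter_mul_prod_filter_not S (fun p : ℕ => (P₁ : ℝ) < (p : ℝ))]
    have hA : ∏ p ∈ S.filter (fun p : ℕ => (P₁ : ℝ) < (p : ℝ)), g p ≤
        Real.exp (k * (t - 1) * Real.log (Real.log Y) + (k * Real.log (Real.log P₁) + K)) := by
      set T := S.filter (fun p : ℕ => (P₁ : ℝ) < (p : ℝ)) with hT
      have hstep : ∏ p ∈ T, g p ≤ Real.exp (∑ p ∈ T, -((ω p : ℝ) * (1 - t) / p)) := by
        refine prod_le_exp_sum T (fun p _ => hg0 p) fun p hp => ?_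
        rw [hT, mem_filter] at hp
        obtain ⟨hp1, -, hE⟩ := hSgood p hp.1 hp.2
        exact locE_le_one_real hp1 (π p) ht0 ht1 hE
      refine hstep.trans (Real.exp_le_exp.2 ?_)
      have e : ∑ p ∈ T, -((ω p : ℝ) * (1 - t) / p) = -(1 - t) * ∑ p ∈ T, (ω p : ℝ) / p := by
        rw [mul_sum]
        exact sum_congr rfl fun p _ => by ring
      rw [e]
      have hΩ := (abs_le.1 (hM P₁ Y hP₁' hY)).1
      have h1t : 0 ≤ 1 - t := by linarith
      have := mul_le_mul_of_nonneg_left hΩ h1t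
      have h2 : (1 - t) * (k * Real.log (Real.log P₁) + K) ≤ k * Real.log (Real.log P₁) + K := by
        have h0 : 0 ≤ k * Real.log (Real.log P₁) + K := by positivity
        have := mul_nonneg ht0 h0
        linarith
      linarith
    have hB : ∏ p ∈ S.filter (fun p : ℕ => ¬(P₁ : ℝ) < (p : ℝ)), g p ≤ 1 :=
      prod_le_one (fun p _ => hg0 p) fun p _ =>
        (locE_div_le_trivial (π p) (hπk p) ht0).trans (by rw [max_eq_left ht1, one_pow])
    calc (∏ p ∈ S.filter (fun p : ℕ => (P₁ : ℝ) < (p : ℝ)), g p) *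
          ∏ p ∈ S.filter (fun p : ℕ => ¬(P₁ : ℝ) < (p : ℝ)), g p
        ≤ Real.exp (k * (t - 1) * Real.log (Real.log Y) + (k * Real.log (Real.log P₁) + K)) * 1 :=
          mul_le_mul hA hB (prod_nonneg fun p _ => hg0 p) (Real.exp_pos _).le
      _ ≤ Real.exp (k * (t - 1) * Real.log (Real.log Y) + C * (t + 1)) := by
          rw [mul_one, Real.exp_le_exp]
          have h1 : k * Real.log (Real.log P₁) + K ≤ C := by
            rw [hC]
            have : 0 ≤ Real.log K₀ + 4 := by positivity
            have : (0 : ℝ) ≤ 2 * k * (P₁ + 1) := by positivity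
            linarith
          have h2 : C ≤ C * (t + 1) := le_mul_of_one_le_right hC0 (by linarith)
          linarith
  · -- `t > 1`: bad primes `≤ t^{2k}`, small good primes by Stirling, large good primes by Mertens
    set u : ℝ := t + 1 with hu
    set P : ℝ := max (P₁ : ℝ) u with hP
    have hu2 : 2 ≤ u := by linarith
    have hP3 : 3 ≤ P := le_trans hP₁' (le_max_left _ _)
    have hPu : u ≤ P := le_max_right _ _
    rw [← prod_filter_mul_prod_filter_not S (fun p : ℕ => P < (p : ℝ)),
      ← prod_filter_mul_prod_filter_not (S.filter fun p : ℕ => ¬P < (p : ℝ))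
        (fun p : ℕ => (P₁ : ℝ) < (p : ℝ))]
    -- large good primes
    have hlarge : ∏ p ∈ S.filter (fun p : ℕ => P < (p : ℝ)), g p ≤
        Real.exp (k * (t - 1) * Real.log (Real.log Y) + K * (t - 1) + 2 * D * t) := by
      set T := S.filter (fun p : ℕ => P < (p : ℝ)) with hT
      have hstep : ∏ p ∈ T, g p ≤
          Real.exp (∑ p ∈ T, ((ω p : ℝ) * (t - 1) / p + D * t * (t - 1) / (p : ℝ) ^ 2)) := by
        refine prod_le_exp_sum T (fun p _ => hg0 p) fun p hp => ?_
        rw [hT, mem_filter] at hp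
        obtain ⟨hp1, hωD, hE⟩ := hSgood p hp.1 (lt_of_le_of_lt (le_max_left _ _) hp.2)
        exact locE_large_real hp1 (π p) hωD ht1.le hE
      refine hstep.trans (Real.exp_le_exp.2 ?_)
      rw [sum_add_distrib]
      have h2 : ∑ p ∈ T, (D : ℝ) * t * (t - 1) / (p : ℝ) ^ 2 ≤ 2 * D * t := by
        have hs := sum_inv_sq_filter_le (S := S) (N := ⌊Y⌋₊)
          (fun p hp => (Nat.mem_primesLE.1 hp).1) (show 0 < P by linarith)
        have hX0 : 0 ≤ (D : ℝ) * t * (t - 1) := by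
          have := mul_nonneg hD0 ht0
          exact mul_nonneg this (by linarith)
        calc ∑ p ∈ T, (D : ℝ) * t * (t - 1) / (p : ℝ) ^ 2
            = D * t * (t - 1) * ∑ p ∈ T, 1 / (p : ℝ) ^ 2 := by
              rw [mul_sum]
              exact sum_congr rfl fun p _ => by ring
          _ ≤ D * t * (t - 1) * (2 / P) := mul_le_mul_of_nonneg_left hs hX0
          _ ≤ D * t * (t - 1) * (2 / u) := by gcongr
          _ ≤ 2 * D * t := by
              rw [hu, ← mul_div_assoc, div_le_iff₀ (by linarith)]
              linarith [mul_nonneg hD0 ht0]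
      have h1 : ∑ p ∈ T, (ω p : ℝ) * (t - 1) / p ≤
          k * (t - 1) * Real.log (Real.log Y) + K * (t - 1) := by
        have e : ∑ p ∈ T, (ω p : ℝ) * (t - 1) / p = (t - 1) * ∑ p ∈ T, (ω p : ℝ) / p := by
          rw [mul_sum]
          exact sum_congr rfl fun p _ => by ring
        rw [e]
        have ht1' : 0 ≤ t - 1 := by linarith
        by_cases hPY : P ≤ Y
        · have hΩ := (abs_le.1 (hM P Y hP3 hPY)).2
          have hllP : 0 ≤ Real.log (Real.log P) := Real.log_nonneg
            (Literature.NumberTheory.LFunctions.MertensBound.one_lt_log_three.le.trans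
              (Real.log_le_log (by norm_num) hP3))
          have h3 : ∑ p ∈ T, (ω p : ℝ) / p ≤ k * Real.log (Real.log Y) + K := by
            linarith [mul_nonneg hk0 hllP]
          have := mul_le_mul_of_nonneg_left h3 ht1'
          linarith
        · have hT0 : T = ∅ := by
            rw [hT]
            refine filter_false_of_mem fun p hp => ?_
            have : (p : ℝ) ≤ Y :=
              le_trans (by exact_mod_cast (Nat.mem_primesLE.1 hp).1) (Nat.floor_le (by linarith))
            push Not at hPY
            linarith
          rw [hT0, sum_empty, mul_zero]
          have := mul_nonneg ht1' (mul_nonneg hk0 hllY)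
          have := mul_nonneg hK ht1'
          linarith
      linarith [h1, h2]
    -- small good primes
    have hmid : ∏ p ∈ (S.filter fun p : ℕ => ¬P < (p : ℝ)).filter (fun p : ℕ => (P₁ : ℝ) < (p : ℝ)),
        g p ≤ Real.exp ((Real.log K₀ + 4) * u) := by
      set T := (S.filter fun p : ℕ => ¬P < (p : ℝ)).filter (fun p : ℕ => (P₁ : ℝ) < (p : ℝ)) with hT
      have hTm : ∀ p ∈ T, p ∈ S ∧ (P₁ : ℝ) < p ∧ (p : ℝ) ≤ u := by
        intro p hp
        rw [hT, mem_filter, mem_filter, not_lt] at hp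
        refine ⟨hp.1.1, hp.2, ?_⟩
        rcases le_max_iff.1 hp.1.2 with h | h
        · exact absurd hp.2 (not_lt.2 h)
        · exact h
      calc ∏ p ∈ T, g p ≤ ∏ p ∈ T, K₀ * u ^ 2 / (p : ℝ) ^ 2 := by
            refine prod_le_prod (fun p _ => hg0 p) fun p hp => ?_
            obtain ⟨hpS, hp1, hpu⟩ := hTm p hp
            obtain ⟨hp1', hωD, hE⟩ := hSgood p hpS hp1
            exact locE_small_real hp1' (π p) hωD ht1.le hpu hE
        _ ≤ Real.exp ((Real.log K₀ + 4) * u) :=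
            prod_mul_sq_div_sq_le hu2 hK₀1 fun p hp =>
              ⟨(hSgood p (hTm p hp).1 (hTm p hp).2.1).1, (hTm p hp).2.2⟩
    -- bad primes
    have hbad : ∏ p ∈ (S.filter fun p : ℕ => ¬P < (p : ℝ)).filter (fun p : ℕ => ¬(P₁ : ℝ) < (p : ℝ)),
        g p ≤ Real.exp (2 * k * (P₁ + 1) * t) := by
      set T := (S.filter fun p : ℕ => ¬P < (p : ℝ)).filter (fun p : ℕ => ¬(P₁ : ℝ) < (p : ℝ)) with hT
      have hcard : #T ≤ P₁ + 1 := by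
        have hsub : T ⊆ range (P₁ + 1) := by
          intro p hp
          rw [hT, mem_filter, not_lt] at hp
          exact mem_range.2 (Nat.lt_succ_of_le (by exact_mod_cast hp.2))
        exact (card_le_card hsub).trans (card_range _).le
      have hB : ∀ p ∈ T, g p ≤ t ^ (2 * k) := fun p _ =>
        (locE_div_le_trivial (π p) (hπk p) ht0).trans (by rw [max_eq_right ht1.le])
      refine (prod_le_pow_card_of_le T (fun p _ => hg0 p) hB).trans ?_
      rw [← pow_mul]
      calc t ^ (2 * k * #T) ≤ t ^ (2 * k * (P₁ + 1)) :=
            pow_le_pow_right₀ ht1.le (Nat.mul_le_mul_left _ hcard)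
        _ = Real.exp (2 * k * (P₁ + 1) * Real.log t) := by
            rw [← Real.exp_log (pow_pos (by linarith) _), Real.log_pow]
            push_cast
            ring_nf
        _ ≤ Real.exp (2 * k * (P₁ + 1) * t) := by
            rw [Real.exp_le_exp]
            exact mul_le_mul_of_nonneg_left (by linarith [Real.log_le_sub_one_of_pos (by linarith : 0 < t)])
              (by positivity)
    calc (∏ p ∈ S.filter (fun p : ℕ => P < (p : ℝ)), g p) *
          ((∏ p ∈ (S.filter fun p : ℕ => ¬P < (p : ℝ)).filter (fun p : ℕ => (P₁ : ℝ) < (p : ℝ)), g p) *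
            ∏ p ∈ (S.filter fun p : ℕ => ¬P < (p : ℝ)).filter (fun p : ℕ => ¬(P₁ : ℝ) < (p : ℝ)), g p)
        ≤ Real.exp (k * (t - 1) * Real.log (Real.log Y) + K * (t - 1) + 2 * D * t) *
            (Real.exp ((Real.log K₀ + 4) * u) * Real.exp (2 * k * (P₁ + 1) * t)) :=
          mul_le_mul hlarge (mul_le_mul hmid hbad (prod_nonneg fun p _ => hg0 p) (Real.exp_pos _).le)
            (mul_nonneg (prod_nonneg fun p _ => hg0 p) (prod_nonneg fun p _ => hg0 p))
            (Real.exp_pos _).le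
      _ = Real.exp (k * (t - 1) * Real.log (Real.log Y) +
            (K * (t - 1) + 2 * D * t + (Real.log K₀ + 4) * u + 2 * k * (P₁ + 1) * t)) := by
          rw [← Real.exp_add, ← Real.exp_add]
          congr 1
          ring
      _ ≤ Real.exp (k * (t - 1) * Real.log (Real.log Y) + C * (t + 1)) := by
          rw [Real.exp_le_exp, hC, hu]
          have h1 : K * (t - 1) ≤ K * (t + 1) := by linarith
          have h2 : 2 * D * t ≤ 2 * D * (t + 1) := by linarith
          have h3 : 2 * k * (P₁ + 1) * t ≤ 2 * k * (P₁ + 1) * (t + 1) := by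
            have : (0 : ℝ) ≤ 2 * k * (P₁ + 1) := by positivity
            linarith
          have h4 : 0 ≤ (k * Real.log (Real.log P₁) + K) * (t + 1) := by positivity
          linarith


/-- **`stub_eulerBoundReal`** — the Euler-product bound (B) from the local factor law (Stage A): for
`Y ≥ Y₀(f)` and all `z`, `∏_{p ≤ Y} E_p(‖z‖)/p² ≤ (log Y)^{k(‖z‖−1)} e^{C(‖z‖+1)}`. -/
theorem stub_eulerBoundReal :
    (∀ (k : ℕ) (f : Fin k → Polynomial ℤ), Literature.NumberTheory.Sieve.IsBatemanHornSystem f →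
      ∃ P₀ : ℕ, ∀ p : ℕ, p.Prime → P₀ < p →
        Literature.NumberTheory.Sieve.polyRootCountMod f p ≤ ∑ i, (f i).natDegree ∧
        (∀ b : ℕ, (∑ i, ((if (p : ℤ) ∣ (f i).eval (b : ℤ) then 1 else 0) +
            (if (p : ℤ) ^ 2 ∣ (f i).eval (b : ℤ) then 1 else 0)) : ℕ) ≤ 2) ∧
        ((Finset.range (p ^ 2)).filter (fun b : ℕ =>
            (∑ i, ((if (p : ℤ) ∣ (f i).eval (b : ℤ) then 1 else 0) +
              (if (p : ℤ) ^ 2 ∣ (f i).eval (b : ℤ) then 1 else 0)) : ℕ) = 1)).card =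
          (p - 1) * Literature.NumberTheory.Sieve.polyRootCountMod f p ∧
        ((Finset.range (p ^ 2)).filter (fun b : ℕ =>
            (∑ i, ((if (p : ℤ) ∣ (f i).eval (b : ℤ) then 1 else 0) +
              (if (p : ℤ) ^ 2 ∣ (f i).eval (b : ℤ) then 1 else 0)) : ℕ) = 2)).card =
          Literature.NumberTheory.Sieve.polyRootCountMod f p) →
    ∀ (k : ℕ) (f : Fin k → Polynomial ℤ), Literature.NumberTheory.Sieve.IsBatemanHornSystem f →
      ∃ C Y₀ : ℝ, ∀ Y : ℝ, Y₀ ≤ Y → ∀ z : ℂ,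
        ∏ p ∈ Nat.primesLE ⌊Y⌋₊, (∑ b ∈ Finset.range (p ^ 2),
            ‖z‖ ^ (∑ i, ((if (p : ℤ) ∣ (f i).eval (b : ℤ) then 1 else 0) +
              (if (p : ℤ) ^ 2 ∣ (f i).eval (b : ℤ) then 1 else 0)) : ℕ)) / (p : ℝ) ^ 2 ≤
          (Real.log Y) ^ ((k : ℝ) * (‖z‖ - 1)) * Real.exp (C * (‖z‖ + 1)) := by
  intro hA k f hf
  classical
  obtain ⟨P₀, hP₀⟩ := hA k f hf
  obtain ⟨K, hK0, hM⟩ := stub_mertensOmega k f hf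
  set P₁ : ℕ := max P₀ 3 with hP₁
  have hP₁3 : 3 ≤ P₁ := le_max_right _ _
  set π : ℕ → ℕ → ℕ := fun p b => ∑ i, ((if (p : ℤ) ∣ (f i).eval (b : ℤ) then 1 else 0) +
    (if (p : ℤ) ^ 2 ∣ (f i).eval (b : ℤ) then 1 else 0)) with hπ
  set ω : ℕ → ℕ := fun p => polyRootCountMod f p with hω
  have hπk : ∀ p b, π p b ≤ 2 * k := by
    intro p b
    calc π p b ≤ ∑ _i : Fin k, 2 := sum_le_sum fun i _ => by split_ifs <;> omega
      _ = 2 * k := by simp [mul_comm]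
  have hgood : ∀ p : ℕ, p.Prime → P₁ < p → ω p ≤ ∑ i, (f i).natDegree ∧ ∀ t : ℝ,
      ∑ b ∈ range (p ^ 2), t ^ π p b = (p : ℝ) ^ 2 + ω p * (t - 1) * (p + t) := by
    intro p hp hp1
    obtain ⟨hωD, hle2, h1, h2⟩ := hP₀ p hp (lt_of_le_of_lt (le_max_left _ _) hp1)
    exact ⟨hωD, fun t => locE_good hp.one_le (π p) hle2 h1 h2 t⟩
  obtain ⟨C, -, hB⟩ := engine_real π ω hP₁3 hK0 hπk hgood hM
  exact ⟨C, P₁, fun Y hY z => hB Y hY ‖z‖ (norm_nonneg z)⟩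

/-- **Stage B `stub_eulerProductBounds`** (the two Euler-product bounds, from Stage A): granting the
local factor law, for every Bateman–Horn system there are `A, C, Y₀` such that for all real `Y ≥ Y₀`
and all `z ∈ ℂ`: (Λ) `‖∏_{p ≤ Y} E_p(z)/p²‖ ≤ A (log Y)^{k(Re z − 1)} exp(C ‖z−1‖ log(‖z−1‖+2))`;
(B) `∏_{p ≤ Y} E_p(‖z‖)/p² ≤ (log Y)^{k(‖z‖ − 1)} exp(C (‖z‖ + 1))`. -/
theorem stub_eulerProductBounds :
    (∀ (k : ℕ) (f : Fin k → Polynomial ℤ), Literature.NumberTheory.Sieve.IsBatemanHornSystem f →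
      ∃ P₀ : ℕ, ∀ p : ℕ, p.Prime → P₀ < p →
        Literature.NumberTheory.Sieve.polyRootCountMod f p ≤ ∑ i, (f i).natDegree ∧
        (∀ b : ℕ, (∑ i, ((if (p : ℤ) ∣ (f i).eval (b : ℤ) then 1 else 0) +
            (if (p : ℤ) ^ 2 ∣ (f i).eval (b : ℤ) then 1 else 0)) : ℕ) ≤ 2) ∧
        ((Finset.range (p ^ 2)).filter (fun b : ℕ =>
            (∑ i, ((if (p : ℤ) ∣ (f i).eval (b : ℤ) then 1 else 0) +
              (if (p : ℤ) ^ 2 ∣ (f i).eval (b : ℤ) then 1 else 0)) : ℕ) = 1)).card =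
          (p - 1) * Literature.NumberTheory.Sieve.polyRootCountMod f p ∧
        ((Finset.range (p ^ 2)).filter (fun b : ℕ =>
            (∑ i, ((if (p : ℤ) ∣ (f i).eval (b : ℤ) then 1 else 0) +
              (if (p : ℤ) ^ 2 ∣ (f i).eval (b : ℤ) then 1 else 0)) : ℕ) = 2)).card =
          Literature.NumberTheory.Sieve.polyRootCountMod f p) →
    ∀ (k : ℕ) (f : Fin k → Polynomial ℤ), Literature.NumberTheory.Sieve.IsBatemanHornSystem f →
      ∃ A C Y₀ : ℝ, ∀ Y : ℝ, Y₀ ≤ Y → ∀ z : ℂ,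
        ‖∏ p ∈ Nat.primesLE ⌊Y⌋₊, (∑ b ∈ Finset.range (p ^ 2),
            z ^ (∑ i, ((if (p : ℤ) ∣ (f i).eval (b : ℤ) then 1 else 0) +
              (if (p : ℤ) ^ 2 ∣ (f i).eval (b : ℤ) then 1 else 0)) : ℕ)) / (p : ℂ) ^ 2‖ ≤
          A * (Real.log Y) ^ ((k : ℝ) * (z.re - 1)) * Real.exp (C * ‖z - 1‖ * Real.log (‖z - 1‖ + 2)) ∧
        ∏ p ∈ Nat.primesLE ⌊Y⌋₊, (∑ b ∈ Finset.range (p ^ 2),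
            ‖z‖ ^ (∑ i, ((if (p : ℤ) ∣ (f i).eval (b : ℤ) then 1 else 0) +
              (if (p : ℤ) ^ 2 ∣ (f i).eval (b : ℤ) then 1 else 0)) : ℕ)) / (p : ℝ) ^ 2 ≤
          (Real.log Y) ^ ((k : ℝ) * (‖z‖ - 1)) * Real.exp (C * (‖z‖ + 1)) := by
  intro hA k f hf
  obtain ⟨A, C₁, Y₁, hA0, h₁⟩ := stub_eulerBoundComplex hA k f hf
  obtain ⟨C₂, Y₂, h₂⟩ := stub_eulerBoundReal hA k f hf
  refine ⟨A, max C₁ C₂, max (max Y₁ Y₂) 1, fun Y hY z => ⟨?_, ?_⟩⟩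
  · have hY₁ : Y₁ ≤ Y := le_trans (le_trans (le_max_left _ _) (le_max_left _ _)) hY
    have hY1 : 1 ≤ Y := le_trans (le_max_right _ _) hY
    refine (h₁ Y hY₁ z).trans ?_
    have h0 : 0 ≤ A * Real.log Y ^ ((k : ℝ) * (z.re - 1)) :=
      mul_nonneg hA0 (Real.rpow_nonneg (Real.log_nonneg hY1) _)
    refine mul_le_mul_of_nonneg_left (Real.exp_le_exp.2 ?_) h0
    exact mul_le_mul_of_nonneg_right (mul_le_mul_of_nonneg_right (le_max_left _ _) (norm_nonneg _))
      (Real.log_nonneg (by linarith [norm_nonneg (z - 1)]))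
  · have hY₂ : Y₂ ≤ Y := le_trans (le_trans (le_max_right _ _) (le_max_left _ _)) hY
    have hY1 : 1 ≤ Y := le_trans (le_max_right _ _) hY
    refine (h₂ Y hY₂ z).trans ?_
    refine mul_le_mul_of_nonneg_left (Real.exp_le_exp.2 ?_)
      (Real.rpow_nonneg (Real.log_nonneg hY1) _)
    exact mul_le_mul_of_nonneg_right (le_max_right _ _) (by positivity)

end Summit.Parity.BatemanHorn.Cruxes.SystemZeroRepulsion.SmoothRoughLatticeAcquisition

end
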